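import Literature.Analysis.Convexity.HopfContraction
import Literature.Analysis.Convexity.DoeblinRatioStep
import HarnessLib

/-!
# Kesten's multilevel ratio scheme: supersolutions bound the oscillation (proved)

Topic `Literature/Analysis/Convexity`. The bookkeeping that assembles H. Kesten's ratio-limit
argument (PTRF 73 (1986), §2, eqs. (22)–(25)) from its one-level ingredients
(`HopfContraction.lean`, `DoeblinRatioStep.lean`). Levels `l = 0, 1, …, L` carry finite nonempty
index sets `s l` ("data"); consecutive levels are linked by positive kernels `M l C D`
(`C ∈ s (l+1)`, `D ∈ s l`) whose cross-ratios are bounded by a constant `K ≥ 1`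
(`M l C D · M l C' D' ≤ K · M l C D' · M l C' D`, Kesten's Lemma (23)); two families `U l`, `U' l`
(SAME kernels, different positive level-`0` vectors `U 0`, `U' 0`, different junk) satisfy the
decomposition with junk of relative size `≤ ε < 1` (eq. (22)) in the two-sided form

  `Σ_D M l C D · U l D ≤ U (l+1) C`,  `(1 - ε) · U (l+1) C ≤ Σ_D M l C D · U l D`,

and likewise for `U'`. Writing `osc_l = max_{C, C' ∈ s l} [U l C / U' l C] / [U l C' / U' l C']`
for the projective oscillation of `U l` against `U' l`:

* one kernel step bounds it by the cross-ratio constant whatever the level-`0` vectors,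
  `osc_1 ≤ K · (1-ε)⁻²` (`sum_mul_div_div_le_crossRatio_const` plus the junk factor);
* each further step contracts, `osc_{l+1} ≤ (1/K + (1 - 1/K) · osc_l) · (1-ε)⁻²`
  (Hopf's contraction `sum_mul_div_div_le_of_crossRatio` plus the junk factor).

Hence every supersolution `Q` of this recursion (`K (1-ε)⁻² ≤ Q 1`,
`(1/K + (1 - 1/K) Q l)(1-ε)⁻² ≤ Q (l+1)`) bounds the oscillation: `osc_l ≤ Q l` for `1 ≤ l ≤ L`
(`kesten_multilevel_osc_le`). The transfer of a double-ratio bound from the clean sums to the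
junk-perturbed quantities is `div_div_div_le_of_junk`. Everything is proved; no definitions.

## References

* H. Kesten, The incipient infinite cluster in two-dimensional percolation, *Probab. Theory Related
  Fields* 73 (1986) 369–394, §2, eqs. (22)–(25) and Lemma (23).
* E. Hopf, An inequality for positive linear integral operators, *J. Math. Mech.* 12 (1963)
  683–692, Thm. 1.
-/

open Finset

namespace Literature.Analysis.Convexity.Doeblin

/-- **Junk transfer for a double ratio.** If the clean parts `P, P', R, R' > 0` control the
perturbed quantities `V, V', W, W'` two-sidedly (`P ≤ V`, `(1 - ε) V ≤ P`, etc., `ε < 1`), then a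
bound `B` on the clean double ratio `(P/P')/(R/R')` yields the bound `B (1-ε)⁻²` on
`(V/V')/(W/W')`: the numerator ratio grows by at most `(1-ε)⁻¹`, the denominator ratio shrinks by
at most `(1-ε)`. [cite: Kesten1986, eqs. (22)–(25)] -/
theorem div_div_div_le_of_junk {P P' R R' V V' W W' ε B : ℝ}
    (hP : 0 < P) (hP' : 0 < P') (hR : 0 < R) (hR' : 0 < R') (hε1 : ε < 1)
    (hV : P ≤ V ∧ (1 - ε) * V ≤ P) (hV' : P' ≤ V' ∧ (1 - ε) * V' ≤ P')
    (hW : R ≤ W ∧ (1 - ε) * W ≤ R) (hW' : R' ≤ W' ∧ (1 - ε) * W' ≤ R')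
    (hB : P / P' / (R / R') ≤ B) :
    V / V' / (W / W') ≤ B / (1 - ε) ^ 2 := by
  have h1ε : 0 < 1 - ε := sub_pos.2 hε1
  have hV'0 : 0 < V' := hP'.trans_le hV'.1
  have hW0 : 0 < W := hR.trans_le hW.1
  have hW'0 : 0 < W' := hR'.trans_le hW'.1
  have hB0 : 0 ≤ B := (div_pos (div_pos hP hP') (div_pos hR hR')).le.trans hB
  have hB' : P * R' ≤ B * (P' * R) := by
    rw [div_div_div_eq, div_le_iff₀ (mul_pos hP' hR)] at hB
    exact hB
  have key : (1 - ε) ^ 2 * (V * W') ≤ B * (V' * W) :=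
    calc (1 - ε) ^ 2 * (V * W') = ((1 - ε) * V) * ((1 - ε) * W') := by ring
      _ ≤ P * R' := mul_le_mul hV.2 hW'.2 (mul_nonneg h1ε.le hW'0.le) hP.le
      _ ≤ B * (P' * R) := hB'
      _ ≤ B * (V' * W) :=
          mul_le_mul_of_nonneg_left (mul_le_mul hV'.1 hW.1 hR.le hV'0.le) hB0
  rw [div_div_div_eq, div_le_iff₀ (mul_pos hV'0 hW0), div_mul_eq_mul_div,
    le_div_iff₀ (pow_pos h1ε 2)]
  calc V * W' * (1 - ε) ^ 2 = (1 - ε) ^ 2 * (V * W') := by ring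
    _ ≤ B * (V' * W) := key

/-- **Kesten's multilevel ratio scheme: a supersolution of the contraction recursion bounds the
oscillation.** Levels `0, …, L` with finite nonempty data sets `s l`, positive kernels `M l C D`
(`C ∈ s (l+1)`, `D ∈ s l`) with cross-ratios `≤ K` (`1 ≤ K`, Kesten's Lemma (23)), and two
families `U, U'` with positive level-`0` vectors, each squeezed between its clean one-step sum
`Σ_D M l C D · U l D` and `(1-ε)⁻¹` times it (`0 ≤ ε < 1`, eq. (22)). If `K (1-ε)⁻² ≤ Q 1` and
`(1/K + (1 - 1/K) Q l)(1-ε)⁻² ≤ Q (l+1)` for `1 ≤ l < L`, then for `1 ≤ l ≤ L` and all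
`C, C' ∈ s l`, `[U l C / U' l C] / [U l C' / U' l C'] ≤ Q l`: level `1` by
`sum_mul_div_div_le_crossRatio_const`, the step by Hopf's contraction
`sum_mul_div_div_le_of_crossRatio` with `A` the minimal ratio `U l D / U' l D` over `s l` and
`B = Q l · A`, the junk by `div_div_div_le_of_junk`. [cite: Kesten1986, eqs. (22)–(25)] -/
theorem kesten_multilevel_osc_le {κ : Type*} (s : ℕ → Finset κ) (M : ℕ → κ → κ → ℝ)
    (U U' : ℕ → κ → ℝ) (Q : ℕ → ℝ) {K ε : ℝ} (L : ℕ)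
    (hK : 1 ≤ K) (hε0 : 0 ≤ ε) (hε1 : ε < 1)
    (hne : ∀ l ≤ L, (s l).Nonempty)
    (hM : ∀ l < L, ∀ C ∈ s (l + 1), ∀ D ∈ s l, 0 < M l C D)
    (hcross : ∀ l < L, ∀ C ∈ s (l + 1), ∀ C' ∈ s (l + 1), ∀ D ∈ s l, ∀ D' ∈ s l,
      M l C D * M l C' D' ≤ K * (M l C D' * M l C' D))
    (hU0 : ∀ D ∈ s 0, 0 < U 0 D) (hU0' : ∀ D ∈ s 0, 0 < U' 0 D)
    (hU : ∀ l < L, ∀ C ∈ s (l + 1),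
      ∑ D ∈ s l, M l C D * U l D ≤ U (l + 1) C ∧ (1 - ε) * U (l + 1) C ≤ ∑ D ∈ s l, M l C D * U l D)
    (hU' : ∀ l < L, ∀ C ∈ s (l + 1),
      ∑ D ∈ s l, M l C D * U' l D ≤ U' (l + 1) C ∧
        (1 - ε) * U' (l + 1) C ≤ ∑ D ∈ s l, M l C D * U' l D)
    (hQ1 : K / (1 - ε) ^ 2 ≤ Q 1)
    (hQ : ∀ l, 1 ≤ l → l < L → (1 / K + (1 - 1 / K) * Q l) / (1 - ε) ^ 2 ≤ Q (l + 1)) :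
    ∀ l, 1 ≤ l → l ≤ L → ∀ C ∈ s l, ∀ C' ∈ s l,
      U l C / U' l C / (U l C' / U' l C') ≤ Q l := by
  -- `0 ≤ ε` is part of the scheme's standing hypotheses but is not needed for the bound
  -- (for `ε < 0` the two-sided junk hypotheses are contradictory as soon as `1 ≤ L`).
  have _ := hε0
  -- (i) positivity of `U l`, `U' l` on `s l` for `l ≤ L`: `U (l+1) C ≥ Σ_D M l C D · U l D > 0`.
  have hpos : ∀ l ≤ L, ∀ C ∈ s l, 0 < U l C ∧ 0 < U' l C := by
    intro l
    induction l with
    | zero => exact fun _ C hC => ⟨hU0 C hC, hU0' C hC⟩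
    | succ l ih =>
      intro hl C hC
      have hl' : l < L := hl
      exact ⟨(Finset.sum_pos (fun D hD => mul_pos (hM l hl' C hC D hD) (ih hl'.le D hD).1)
          (hne l hl'.le)).trans_le (hU l hl' C hC).1,
        (Finset.sum_pos (fun D hD => mul_pos (hM l hl' C hC D hD) (ih hl'.le D hD).2)
          (hne l hl'.le)).trans_le (hU' l hl' C hC).1⟩
  -- (ii) a bound on the clean double ratios at level `l+1` passes to `U, U'` with `(1-ε)⁻²`.
  have hstep : ∀ l < L, ∀ B : ℝ,
      (∀ C ∈ s (l + 1), ∀ C' ∈ s (l + 1),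
        (∑ D ∈ s l, M l C D * U l D) / (∑ D ∈ s l, M l C D * U' l D) /
          ((∑ D ∈ s l, M l C' D * U l D) / (∑ D ∈ s l, M l C' D * U' l D)) ≤ B) →
      ∀ C ∈ s (l + 1), ∀ C' ∈ s (l + 1),
        U (l + 1) C / U' (l + 1) C / (U (l + 1) C' / U' (l + 1) C') ≤ B / (1 - ε) ^ 2 := by
    intro l hl B hB C hC C' hC'
    have hP : ∀ C ∈ s (l + 1), 0 < ∑ D ∈ s l, M l C D * U l D := fun C hC =>
      Finset.sum_pos (fun D hD => mul_pos (hM l hl C hC D hD) (hpos l hl.le D hD).1) (hne l hl.le)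
    have hP' : ∀ C ∈ s (l + 1), 0 < ∑ D ∈ s l, M l C D * U' l D := fun C hC =>
      Finset.sum_pos (fun D hD => mul_pos (hM l hl C hC D hD) (hpos l hl.le D hD).2) (hne l hl.le)
    exact div_div_div_le_of_junk (hP C hC) (hP' C hC) (hP C' hC') (hP' C' hC') hε1
      (hU l hl C hC) (hU' l hl C hC) (hU l hl C' hC') (hU' l hl C' hC') (hB C hC C' hC')
  -- (iii) induction on `l ≥ 1`.
  intro l hl1
  induction l, hl1 using Nat.le_induction with
  | base =>
    -- level `1`: one kernel step bounds the oscillation by `K` whatever `U 0, U' 0 > 0`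
    intro h1L C hC C' hC'
    have h0L : 0 < L := h1L
    refine (hstep 0 h0L K ?_ C hC C' hC').trans hQ1
    intro C hC C' hC'
    exact sum_mul_div_div_le_crossRatio_const (s 0) (M 0 C) (M 0 C') (U 0) (U' 0)
      (fun D hD => hM 0 h0L C hC D hD) (fun D hD => hM 0 h0L C' hC' D hD)
      (fun D hD D' hD' => (hcross 0 h0L C hC C' hC' D hD D' hD').trans_eq (by ring))
      hU0 hU0' (hne 0 h0L.le)
  | succ l hl1 ih =>
    -- level `l+1`, `1 ≤ l`: Hopf's contraction from the oscillation bound `Q l` at level `l`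
    intro hlL C hC C' hC'
    have hl : l < L := hlL
    have ih' := ih hl.le
    refine (hstep l hl (1 / K + (1 - 1 / K) * Q l) ?_ C hC C' hC').trans (hQ l hl1 hl)
    intro C hC C' hC'
    -- `A` := the minimal ratio `U l D / U' l D` over `s l`, `B := Q l * A`
    obtain ⟨D₀, hD₀, hmin⟩ :=
      Finset.exists_min_image (s l) (fun D => U l D / U' l D) (hne l hl.le)
    have hA0 : 0 < U l D₀ / U' l D₀ := div_pos (hpos l hl.le D₀ hD₀).1 (hpos l hl.le D₀ hD₀).2
    have hr : ∀ D ∈ s l, U l D₀ / U' l D₀ ≤ U l D / U' l D ∧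
        U l D / U' l D ≤ Q l * (U l D₀ / U' l D₀) := fun D hD =>
      ⟨hmin D hD, (div_le_iff₀ hA0).1 (ih' D hD D₀ hD₀)⟩
    have key := sum_mul_div_div_le_of_crossRatio (s l) (M l C) (M l C') (U l) (U' l)
      (fun D hD => hM l hl C hC D hD) (fun D hD => hM l hl C' hC' D hD) hK
      (fun D hD D' hD' => (hcross l hl C' hC' C hC D hD D' hD').trans_eq (by ring))
      (fun D hD => (hpos l hl.le D hD).1) (fun D hD => (hpos l hl.le D hD).2) hA0 hr (hne l hl.le)
    have heq : 1 / K + (1 - 1 / K) * (Q l * (U l D₀ / U' l D₀)) / (U l D₀ / U' l D₀) =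
        1 / K + (1 - 1 / K) * Q l := by
      rw [mul_div_assoc, mul_div_cancel_right₀ _ hA0.ne']
    exact key.trans_eq heq

end Literature.Analysis.Convexity.Doeblin
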